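import Literature.Dynamics.Ergodic.ErgodicOptimization
import Mathlib.MeasureTheory.Integral.RieszMarkovKakutani.Real
import Mathlib.MeasureTheory.Measure.HasOuterApproxClosed
import Mathlib.Dynamics.Ergodic.MeasurePreserving
import Mathlib.Analysis.SpecificLimits.Basic
import Mathlib.Topology.Ultrafilter
import HarnessLib

/-!
# Ergodic optimisation: the maximum ergodic average — proof (discharge of the named fact)

Topic `Literature/Dynamics/Ergodic`. This file PROVES the named fact of
`Literature/Dynamics/Ergodic/ErgodicOptimization.lean`:
`jenkinson_maxErgodicAverage_holds : jenkinson_maxErgodicAverage` (O. Jenkinson, *Ergodic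
optimization in dynamical systems*, Ergodic Theory Dynam. Systems 39 (2019) 2593–2618
= arXiv:1712.02307, §2: Def. 2.1, Prop. 2.2 (third equality
`β(f) = limsup_{n→∞} (1/n) sup_{x∈X} Sₙf(x)`) and Prop. 2.3 (i) (existence of an `f`-maximizing
measure), for a continuous self-map `T` of a nonempty compact metric space and continuous `f`).
It is kept as a sibling `…Proofs` module so that the statement file stays light; nothing here is
a definition or a new named fact.

Jenkinson 2018 gives no proof ("The following is well known (see e.g. [jeo])", i.e.
O. Jenkinson, *Ergodic optimization*, Discrete Contin. Dyn. Syst. 15 (2006) 197–224, Prop. 2.1–2.2);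
the standard argument formalised below is:

* **upper bound** (`integral_le_birkhoffSum_div_of_invariant`): for a `T`-invariant probability
  `μ` and `n ≥ 1`, invariance gives `∫ f dμ = (1/n) ∫ Sₙf dμ ≤ (1/n) supₓ Sₙf(x)`, hence
  `∫ f dμ ≤ L := limsupₙ (1/n) supₓ Sₙf`;
* **attainment** (Krylov–Bogolyubov along maximising orbit segments,
  `exists_invariantMeasure_tendsto_timeAverage`): pick maximisers `xₙ` of the continuous `Sₙf`
  on the compact `X` and an ultrafilter `𝒰 → ∞` on `ℕ` along which `(1/n) Sₙf(xₙ) → L` (`L` is a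
  cluster value of a bounded real sequence's `limsup`); the `𝒰`-limit `m` of the empirical
  measures `(1/n) ∑_{i<n} δ_{Tⁱxₙ}` is a `T`-invariant Borel probability measure with
  `∫ g dm = lim_𝒰 (1/n) Sₙg(xₙ)` for all continuous `g`, in particular `∫ f dm = L`. Combined with
  the upper bound, `m` is `f`-maximizing and `∫ f dm = L`, which is the statement.

Deviation from the printed road (Mathlib supplies the step): instead of a weak-* accumulation
point of the empirical measures we apply the Riesz–Markov–Kakutani theorem
(`RealRMK.rieszMeasure`, `RealRMK.integral_rieszMeasure`) to the positive linear functional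
`g ↦ lim_𝒰 (1/n) Sₙg(xₙ)` on `C_c(X, ℝ) = C(X, ℝ)` (`exists_positiveLinearMap_tendsto`) — this is
exactly how Mathlib proves `CompactSpace (ProbabilityMeasure X)` — and identify `T_* m = m` by
`MeasureTheory.ext_of_forall_integral_eq_of_IsFiniteMeasure` (integrals of bounded continuous
functions), using `(1/n)(Sₙ(g ∘ T) − Sₙg)(xₙ) = (g(Tⁿxₙ) − g(xₙ))/n → 0`
(`birkhoffSum_apply_sub_birkhoffSum`).

## References

* O. Jenkinson, *Ergodic optimization in dynamical systems*, Ergodic Theory Dynam. Systems 39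
  (2019) 2593–2618, doi:10.1017/etds.2017.142, arXiv:1712.02307: §2, Def. 2.1, Prop. 2.2,
  Prop. 2.3 (i). [Jenkinson2018]
* O. Jenkinson, *Ergodic optimization*, Discrete Contin. Dyn. Syst. 15 (2006) 197–224,
  doi:10.3934/dcds.2006.15.197: Prop. 2.1–2.2 (the proofs referred to as [jeo]).
* N. Kryloff, N. Bogoliouboff, *La théorie générale de la mesure dans son application à l'étude
  des systèmes dynamiques de la mécanique non linéaire*, Ann. of Math. 38 (1937) 65–113
  (existence of invariant measures via limits of empirical measures).
-/

noncomputable section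

open MeasureTheory Filter Topology

namespace Literature.Dynamics.Ergodic

universe u

section Proof

open scoped CompactlySupported
open Function Set CompactlySupportedContinuousMap

variable {X : Type*} {T : X → X}

/-- `|(1/n) Sₙg(y)| ≤ sup |g|`. [folklore] -/
private theorem abs_birkhoffSum_div_le {g : X → ℝ} {C : ℝ} (hC : ∀ y, |g y| ≤ C) (n : ℕ)
    (y : X) : |birkhoffSum T g n y / n| ≤ C := by
  rcases Nat.eq_zero_or_pos n with rfl | hn
  · simpa using (abs_nonneg _).trans (hC y)
  · rw [abs_div, Nat.abs_cast, div_le_iff₀ (by exact_mod_cast hn)]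
    calc |birkhoffSum T g n y| ≤ ∑ k ∈ Finset.range n, |g (T^[k] y)| :=
          Finset.abs_sum_le_sum_abs _ _
      _ ≤ ∑ _k ∈ Finset.range n, C := Finset.sum_le_sum fun k _ => hC _
      _ = C * n := by simp [mul_comm]

/-- `Sₙ(g ∘ T)(y) = Sₙg(Ty)`. [folklore] -/
private theorem birkhoffSum_comp_apply (g : X → ℝ) (n : ℕ) (y : X) :
    birkhoffSum T (g ∘ T) n y = birkhoffSum T g n (T y) := by
  unfold birkhoffSum
  refine Finset.sum_congr rfl fun k _ => ?_
  rw [comp_apply, ← iterate_succ_apply' T k, iterate_succ_apply]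

variable [MetricSpace X] [CompactSpace X] [Nonempty X]

/-- A continuous real function on a nonempty compact space is bounded in absolute value.
[folklore] -/
private theorem exists_forall_abs_le {g : X → ℝ} (hg : Continuous g) : ∃ C, ∀ y, |g y| ≤ C := by
  obtain ⟨y₀, hy₀⟩ := (continuous_abs.comp hg).exists_forall_ge
    (by rw [Filter.cocompact_eq_bot]; exact tendsto_bot)
  exact ⟨|g y₀|, hy₀⟩

/-- The ultrafilter limit `g ↦ lim_𝒰 (1/n) Sₙg(xₙ)` of the time averages along a sequence of
points `xₙ` exists and is a positive linear functional on `C_c(X, ℝ) = C(X, ℝ)`. [folklore] -/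
private theorem exists_positiveLinearMap_tendsto (𝒰 : Ultrafilter ℕ) (x : ℕ → X) :
    ∃ Λ : C_c(X, ℝ) →ₚ[ℝ] ℝ, ∀ g : C_c(X, ℝ),
      Tendsto (fun n => birkhoffSum T g n (x n) / (n : ℝ)) (𝒰 : Filter ℕ) (𝓝 (Λ g)) := by
  -- the limit exists for every continuous `g`, by compactness of `[-C, C]`
  have hlim : ∀ g : C_c(X, ℝ), Tendsto (fun n => birkhoffSum T g n (x n) / (n : ℝ))
      (𝒰 : Filter ℕ) (𝓝 (limUnder (𝒰 : Filter ℕ) fun n => birkhoffSum T g n (x n) / (n : ℝ))) := by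
    intro g
    refine tendsto_nhds_limUnder ?_
    obtain ⟨C, hC⟩ := exists_forall_abs_le g.continuous
    have hmem : Icc (-C) C ∈ 𝒰.map (fun n => birkhoffSum T g n (x n) / (n : ℝ)) :=
      Ultrafilter.mem_map.2 (Filter.Eventually.of_forall fun n =>
        abs_le.1 (abs_birkhoffSum_div_le hC n (x n)))
    obtain ⟨l, -, hl⟩ := isCompact_Icc.ultrafilter_le_nhds' _ hmem
    exact ⟨l, hl⟩
  refine ⟨{ toFun := fun g => limUnder (𝒰 : Filter ℕ) fun n => birkhoffSum T g n (x n) / (n : ℝ)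
            map_add' := ?_
            map_smul' := ?_
            monotone' := ?_ }, hlim⟩
  · intro g g'
    refine tendsto_nhds_unique (hlim (g + g')) ?_
    refine ((hlim g).add (hlim g')).congr fun n => ?_
    rw [coe_add, birkhoffSum_add', add_div]
  · intro c g
    simp only [RingHom.id_apply, smul_eq_mul]
    refine tendsto_nhds_unique (hlim (c • g)) ?_
    refine ((hlim g).const_mul c).congr fun n => ?_
    rw [coe_smul, mul_div_assoc']
    congr 1
    simp [birkhoffSum, Finset.mul_sum]
  · intro g g' hle
    exact le_of_tendsto_of_tendsto' (hlim g) (hlim g') fun n =>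
      div_le_div_of_nonneg_right (Finset.sum_le_sum fun k _ => le_def.1 hle _) (Nat.cast_nonneg n)

variable [MeasurableSpace X] [BorelSpace X]

/-- **Krylov–Bogolyubov along an ultrafilter.** For `T` continuous, points `xₙ` and an
ultrafilter `𝒰 → ∞` on `ℕ`, there is a `T`-invariant Borel probability measure `m` with
`∫ g dm = lim_𝒰 (1/n) Sₙg(xₙ)` for every continuous `g` (the `𝒰`-limit of the empirical
measures, obtained from the Riesz–Markov–Kakutani theorem). [folklore] -/
theorem exists_invariantMeasure_tendsto_timeAverage (hT : Continuous T) {𝒰 : Ultrafilter ℕ}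
    (h𝒰 : (𝒰 : Filter ℕ) ≤ atTop) (x : ℕ → X) :
    ∃ m : Measure X, IsProbabilityMeasure m ∧ Measure.map T m = m ∧
      ∀ g : X → ℝ, Continuous g →
        Tendsto (fun n => birkhoffSum T g n (x n) / (n : ℝ)) (𝒰 : Filter ℕ) (𝓝 (∫ y, g y ∂m)) := by
  obtain ⟨Λ, hΛ⟩ := exists_positiveLinearMap_tendsto (T := T) 𝒰 x
  -- integrals of continuous functions against the Riesz measure are the `𝒰`-limits
  have hint : ∀ g : X → ℝ, Continuous g → Tendsto (fun n => birkhoffSum T g n (x n) / (n : ℝ))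
      (𝒰 : Filter ℕ) (𝓝 (∫ y, g y ∂(RealRMK.rieszMeasure Λ))) := by
    intro g hg
    let gc : C_c(X, ℝ) := ⟨⟨g, hg⟩, HasCompactSupport.of_compactSpace g⟩
    have h1 : ∫ y, g y ∂(RealRMK.rieszMeasure Λ) = Λ gc := RealRMK.integral_rieszMeasure Λ gc
    rw [h1]
    exact hΛ gc
  -- total mass one: `(1/n) Sₙ1 = 1` for `n ≥ 1`
  have huniv : RealRMK.rieszMeasure Λ univ = 1 := by
    have h1 : Tendsto (fun n => birkhoffSum T (fun _ => (1 : ℝ)) n (x n) / (n : ℝ))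
        (𝒰 : Filter ℕ) (𝓝 1) := by
      refine tendsto_const_nhds.congr' ?_
      filter_upwards [Filter.Eventually.filter_mono h𝒰 (eventually_ne_atTop 0)] with n hn
      simp [birkhoffSum, hn]
    have h2 := tendsto_nhds_unique (hint _ continuous_const) h1
    simp only [integral_const, smul_eq_mul, mul_one, measureReal_def] at h2
    exact (ENNReal.toReal_eq_one_iff _).1 h2
  haveI hprob : IsProbabilityMeasure (RealRMK.rieszMeasure Λ) := ⟨huniv⟩
  refine ⟨RealRMK.rieszMeasure Λ, hprob, ?_, hint⟩
  -- invariance: the integrals of bounded continuous functions against `T_* m` and `m` agree,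
  -- because `(1/n) (Sₙ(g ∘ T) - Sₙg)(xₙ) = (1/n) (g (Tⁿxₙ) - g xₙ) → 0`
  refine ext_of_forall_integral_eq_of_IsFiniteMeasure fun g => ?_
  rw [integral_map hT.measurable.aemeasurable g.continuous.aestronglyMeasurable]
  have hg' : Tendsto (fun n => birkhoffSum T (g ∘ T) n (x n) / (n : ℝ)) (𝒰 : Filter ℕ)
      (𝓝 (∫ y, g y ∂(RealRMK.rieszMeasure Λ))) := by
    obtain ⟨C, hC⟩ := exists_forall_abs_le g.continuous
    have h0 : Tendsto (fun n => birkhoffSum T (g ∘ T) n (x n) / (n : ℝ)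
        - birkhoffSum T g n (x n) / (n : ℝ)) (𝒰 : Filter ℕ) (𝓝 0) := by
      refine Tendsto.mono_left ?_ h𝒰
      refine squeeze_zero_norm (fun n => ?_) (tendsto_const_div_atTop_nhds_zero_nat (C + C))
      rw [← sub_div, birkhoffSum_comp_apply, birkhoffSum_apply_sub_birkhoffSum, Real.norm_eq_abs,
        abs_div, Nat.abs_cast]
      exact div_le_div_of_nonneg_right ((abs_sub _ _).trans (add_le_add (hC _) (hC _)))
        (Nat.cast_nonneg n)
    simpa using (hint g g.continuous).add h0
  exact tendsto_nhds_unique (hint _ (g.continuous.comp hT)) hg'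

omit [Nonempty X] in
/-- The upper bound `∫ f dμ ≤ (1/n) Sₙf(x₀)` for a `T`-invariant probability measure `μ`, `n ≥ 1`
and a maximiser `x₀` of `Sₙf` (since `∫ f dμ = (1/n) ∫ Sₙf dμ`).
[cite: Jenkinson2018, Prop. 2.2] -/
theorem integral_le_birkhoffSum_div_of_invariant (hT : Continuous T) {f : X → ℝ}
    (hf : Continuous f) (μ : Measure X) [IsProbabilityMeasure μ] (hinv : Measure.map T μ = μ)
    {n : ℕ} (hn : n ≠ 0)
    {x₀ : X} (hx₀ : ∀ y, birkhoffSum T f n y ≤ birkhoffSum T f n x₀) :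
    ∫ y, f y ∂μ ≤ birkhoffSum T f n x₀ / n := by
  have hmp : MeasurePreserving T μ μ := ⟨hT.measurable, hinv⟩
  have hk : ∀ k, ∫ y, f (T^[k] y) ∂μ = ∫ y, f y ∂μ := fun k => by
    rw [← integral_map (hT.measurable.iterate k).aemeasurable hf.aestronglyMeasurable,
      (hmp.iterate k).map_eq]
  have hintk : ∀ k, Integrable (fun y => f (T^[k] y)) μ := fun k =>
    (hf.comp (hT.iterate k)).integrable_of_hasCompactSupport (HasCompactSupport.of_compactSpace _)
  have hSn : Integrable (birkhoffSum T f n) μ := by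
    have : Integrable (fun y => ∑ k ∈ Finset.range n, f (T^[k] y)) μ :=
      integrable_finsetSum (Finset.range n) fun k _ => hintk k
    exact this
  have hsum : ∫ y, birkhoffSum T f n y ∂μ = n * ∫ y, f y ∂μ := by
    simp only [birkhoffSum]
    rw [integral_finsetSum (Finset.range n) fun k _ => hintk k]
    simp [hk]
  have hle : ∫ y, birkhoffSum T f n y ∂μ ≤ birkhoffSum T f n x₀ :=
    calc ∫ y, birkhoffSum T f n y ∂μ ≤ ∫ _y, birkhoffSum T f n x₀ ∂μ :=
          integral_mono hSn (integrable_const _) hx₀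
      _ = birkhoffSum T f n x₀ := by simp
  rw [le_div_iff₀ (by exact_mod_cast Nat.pos_of_ne_zero hn), mul_comm, ← hsum]
  exact hle

end Proof

/-- **Discharge of `jenkinson_maxErgodicAverage`** (Jenkinson 2018, Prop. 2.2 third equality and
Prop. 2.3 (i); proof as in Jenkinson 2006 [jeo], Prop. 2.1–2.2: the upper bound
`∫ f dμ ≤ (1/n) supₓ Sₙf` for invariant `μ`, and a Krylov–Bogolyubov limit of empirical measures
along maximising orbit segments attaining `limsupₙ (1/n) supₓ Sₙf`).
[cite: Jenkinson2018, Prop. 2.2 and Prop. 2.3 (i)] -/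
theorem jenkinson_maxErgodicAverage_holds : jenkinson_maxErgodicAverage.{u} := by
  intro X _ _ _ _ _ T hT f hf
  -- maximisers `xm n` of the continuous functions `Sₙf` on the compact space `X`
  have hcont : ∀ n, Continuous (birkhoffSum T f n) := fun n => by
    have : Continuous fun y => ∑ k ∈ Finset.range n, f (T^[k] y) :=
      continuous_finsetSum (Finset.range n) fun k _ => hf.comp (hT.iterate k)
    exact this
  have hmax : ∀ n, ∃ x₀ : X, ∀ y, birkhoffSum T f n y ≤ birkhoffSum T f n x₀ := fun n =>
    (hcont n).exists_forall_ge (by rw [Filter.cocompact_eq_bot]; exact tendsto_bot)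
  choose xm hxm using hmax
  have hsup : ∀ n, (⨆ y, birkhoffSum T f n y) = birkhoffSum T f n (xm n) := fun n =>
    le_antisymm (ciSup_le (hxm n)) (le_ciSup ⟨_, fun _ ⟨y, hy⟩ => hy ▸ hxm n y⟩ (xm n))
  have ha : (fun n : ℕ => (⨆ y : X, birkhoffSum T f n y) / (n : ℝ)) =
      fun n => birkhoffSum T f n (xm n) / (n : ℝ) := funext fun n => by rw [hsup]
  rw [ha]
  set a : ℕ → ℝ := fun n => birkhoffSum T f n (xm n) / (n : ℝ) with ha_def
  set L : ℝ := limsup a atTop with hL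
  -- `a` is bounded by `sup |f|`
  obtain ⟨C, hC⟩ := exists_forall_abs_le hf
  have habs : ∀ n, |a n| ≤ C := fun n => abs_birkhoffSum_div_le hC n (xm n)
  have hbdd : IsBoundedUnder (· ≤ ·) atTop a :=
    isBoundedUnder_of ⟨C, fun n => (abs_le.1 (habs n)).2⟩
  have hbdd' : IsBoundedUnder (· ≥ ·) atTop a :=
    isBoundedUnder_of ⟨-C, fun n => (abs_le.1 (habs n)).1⟩
  -- Step 1 (upper bound): `∫ f dμ ≤ a n` for `n ≥ 1`, hence `∫ f dμ ≤ L`, for invariant `μ`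
  have hupper : ∀ μ : Measure X, IsProbabilityMeasure μ → Measure.map T μ = μ →
      ∫ y, f y ∂μ ≤ L := by
    intro μ hμ hinv
    refine le_limsup_of_frequently_le (Filter.Eventually.frequently ?_) hbdd
    filter_upwards [eventually_ne_atTop 0] with n hn
    exact integral_le_birkhoffSum_div_of_invariant hT hf μ hinv hn (hxm n)
  -- Step 2: an ultrafilter `𝒰 → ∞` along which `a → L = limsup a`
  have hclust : MapClusterPt L atTop a := by
    rw [mapClusterPt_iff_frequently]
    intro s hs
    obtain ⟨ε, hε, hsub⟩ := Metric.mem_nhds_iff.1 hs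
    have h1 : ∃ᶠ n in atTop, L - ε < a n :=
      frequently_lt_of_lt_limsup hbdd'.isCoboundedUnder_le (show L - ε < L by linarith)
    have h2 : ∀ᶠ n in atTop, a n < L + ε :=
      eventually_lt_of_limsup_lt (show L < L + ε by linarith) hbdd
    refine (h1.and_eventually h2).mono fun n hn => hsub ?_
    rw [Metric.mem_ball, Real.dist_eq, abs_sub_lt_iff]
    exact ⟨by linarith [hn.2], by linarith [hn.1]⟩
  obtain ⟨𝒰, h𝒰, h𝒰L⟩ := mapClusterPt_iff_ultrafilter.1 hclust
  -- Step 3: the `𝒰`-limit `m` of the empirical measures along the maximising segments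
  obtain ⟨m, hm, hinv, hlim⟩ := exists_invariantMeasure_tendsto_timeAverage hT h𝒰 xm
  have hfm : ∫ y, f y ∂m = L := tendsto_nhds_unique (hlim f hf) h𝒰L
  refine ⟨m, hm, hinv, fun μ hμ hμinv => ?_, ?_⟩
  · rw [hfm]
    exact hupper μ hμ hμinv
  · rw [hfm]

end Literature.Dynamics.Ergodic
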